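import Literature.Probability.LatticeModels.SquareTilingModulusLimsup

/-!
# Interior estimates for lattice-harmonic functions on boxes inside a ball
# (the analytic core of [GP19] §4.1, freed from the discretisation)

Support file for `KirchhoffExtremalLength` (route CardyUSTContinuation of `CardyFormulaZ2`, item
stmt-CriticalPhenomena-11234), towards the residual statement `G02ModulusConvergence`
(`…Defs.lean`): the convergence of the effective conductance between the discrete arcs of the
`meshDomain`/`discreteArc` discretisation to the reciprocal extremal distance. The tree proves
[GP19] Cor. 4.15 for the Georgakopoulos–Panagiotis discretisation (`SquareTiling.*`); its interior
estimates (`SquareTiling.exists_forall_abs_sub_le`, `…_mul_dist`, `…abs_second_diff_le`) are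
stated for potentials of THAT discretisation. Here the same three estimates are re-proved under
the discretisation-free hypothesis that `h : ℤ² → [0, 1]` is lattice harmonic on the interior of
every lattice box whose rescaled closed square lies in a fixed closed ball `B̄(z, r)`:

* `abs_sub_le_of_harmonicOnBoxes`: `|h(x + eₖ) - h(x)| ≤ 32 K δ / r` on `B(z, r/4)`;
* `abs_sub_le_mul_dist_of_harmonicOnBoxes`: `|h x - h y| ≤ (64 K / r) |δx - δy|` on `B(z, r/16)`;
* `abs_second_diff_le_of_harmonicOnBoxes`: second differences `≤ 4096 K² δ² / r²` on `B(z, r/16)`.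

(`K = topGradConst`.) They are applied to the potentials of `Ω_δ = discreteDomainGraph Ω δ` in
the companion files, and are equally usable for harmonic conjugates on the dual lattice.
-/

noncomputable section

namespace Summit.CriticalPhenomena.CardyFormulaZ2.Theorems

namespace KirchhoffSlope

open Set Metric Filter Topology
open Literature.Probability.LatticeModels Literature.Probability.LatticeModels.SquareTiling

variable {δ : ℝ}

/-- **Interior gradient estimate, discretisation-free form** ([GP19], Thm 4.3 via the tree's
`harmonic_box_gradient_le`). Let `0 < δ < r / 72` and let `h : ℤ² → [0, 1]` be lattice harmonic
on the interior of every lattice box whose rescaled closed square lies in `B̄(z, r)`. Then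
`|h(x + eₖ) - h(x)| ≤ 32 K δ / r` at every lattice point `x` with mesh point in `B(z, r/4)`.
[cite: GeorgakopoulosPanagiotis2019, §4.1] -/
theorem abs_sub_le_of_harmonicOnBoxes {z : ℂ} {r : ℝ} (hr : 0 < r) (hδ : 0 < δ) (hδr : δ < r / 72)
    {h : Site 2 → ℝ} (h01 : ∀ x, h x ∈ Icc (0 : ℝ) 1)
    (hharm : ∀ (a : Site 2) (N : ℕ),
      Complex.Rectangle (meshPoint δ a) (meshPoint δ (a + ![(N : ℤ), (N : ℤ)])) ⊆ closedBall z r →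
        IsLatticeHarmonicOn h (boxInterior a N))
    (x : Site 2) (hx : meshPoint δ x ∈ ball z (r / 4)) (k : Fin 4) :
    |h (x + cornerUnit k) - h x| ≤ 32 * topGradConst * δ / r := by
  -- the box: side `N = 2M`, `M = ⌊r / (8δ)⌋ ≥ 8`, lower-left corner `a = x - (M, M)`
  set M : ℕ := ⌊r / (8 * δ)⌋₊ with hM
  have hMle : (M : ℝ) ≤ r / (8 * δ) := Nat.floor_le (by positivity)
  have hMge : r / (8 * δ) - 1 ≤ M := (Nat.sub_one_lt_floor _).le
  have h9 : (9 : ℝ) ≤ r / (8 * δ) := by rw [le_div_iff₀ (by positivity)]; linarith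
  have hM8 : 8 ≤ M := by
    have : (8 : ℝ) ≤ M := by linarith
    exact_mod_cast this
  set a : Site 2 := ![x 0 - M, x 1 - M] with ha
  have hxmid : x ∈ boxMiddle a (2 * M) := by
    refine ⟨?_, ?_, ?_, ?_⟩ <;> simp only [ha, Matrix.cons_val_zero, Matrix.cons_val_one] <;> push_cast <;> omega
  -- the closed square lies in `B̄(z, r)`: its points are within `2δM ≤ r/4` of `δx ∈ B(z, r/4)`
  have hsqz : Complex.Rectangle (meshPoint δ a) (meshPoint δ (a + ![((2 * M : ℕ) : ℤ), ((2 * M : ℕ) : ℤ)]))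
      ⊆ closedBall z r := by
    intro p hp
    have h1 := dist_le_of_mem_square hδ.le hp
    have h2 : 2 * δ * M ≤ r / 4 := by
      have := mul_le_mul_of_nonneg_left hMle (by positivity : (0 : ℝ) ≤ 2 * δ)
      rwa [show 2 * δ * (r / (8 * δ)) = r / 4 by field_simp; ring] at this
    rw [mem_closedBall]
    calc dist p z ≤ dist p (meshPoint δ x) + dist (meshPoint δ x) z := dist_triangle _ _ _
      _ ≤ r / 4 + r / 4 := add_le_add (h1.trans h2) (mem_ball.1 hx).le
      _ ≤ r := by linarith
  have hharm' := hharm a (2 * M) hsqz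
  have hgrad := abs_sub_le_of_mem_boxMiddle h01 (by omega) hharm' hxmid k
  refine hgrad.trans ?_
  -- `4K/(2M) ≤ 32 K δ / r` since `2M ≥ r/(8δ)`
  have hK := topGradConst_pos
  have hN' : r / (8 * δ) ≤ ((2 * M : ℕ) : ℝ) := by push_cast; linarith
  have hNpos : (0 : ℝ) < ((2 * M : ℕ) : ℝ) := by positivity
  rw [div_le_div_iff₀ hNpos hr]
  calc 4 * topGradConst * r = 32 * topGradConst * δ * (r / (8 * δ)) := by field_simp; ring
    _ ≤ 32 * topGradConst * δ * ((2 * M : ℕ) : ℝ) := by gcongr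

/-- **Local Lipschitz bound, discretisation-free form** ([GP19], §4.1: the interior gradient
estimate summed along lattice staircases): under the hypotheses of
`abs_sub_le_of_harmonicOnBoxes`, `|h x - h y| ≤ (64 K / r) · |δx - δy|` for lattice points with
mesh points in `B(z, r/16)`. [cite: GeorgakopoulosPanagiotis2019, §4.1] -/
theorem abs_sub_le_mul_dist_of_harmonicOnBoxes {z : ℂ} {r : ℝ} (hr : 0 < r) (hδ : 0 < δ)
    (hδr : δ < r / 72) {h : Site 2 → ℝ} (h01 : ∀ x, h x ∈ Icc (0 : ℝ) 1)
    (hharm : ∀ (a : Site 2) (N : ℕ),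
      Complex.Rectangle (meshPoint δ a) (meshPoint δ (a + ![(N : ℤ), (N : ℤ)])) ⊆ closedBall z r →
        IsLatticeHarmonicOn h (boxInterior a N))
    (x y : Site 2) (hx : meshPoint δ x ∈ ball z (r / 16)) (hy : meshPoint δ y ∈ ball z (r / 16)) :
    |h x - h y| ≤ 64 * topGradConst / r * dist (meshPoint δ x) (meshPoint δ y) := by
  have hK := topGradConst_pos
  have hRect : Complex.Rectangle (meshPoint δ x) (meshPoint δ y) ⊆ ball z (r / 4) := by
    have h2 : (2 : ℝ) * (r / 8) = r / 4 := by ring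
    rw [← h2]
    exact rectangle_subset_ball ((mem_ball.1 hx).trans (by linarith)) ((mem_ball.1 hy).trans (by linarith))
  have key := abs_sub_le_mul_of_steps hδ
    (fun x hx k => abs_sub_le_of_harmonicOnBoxes hr hδ hδr h01 hharm x hx k) _ x y rfl hRect
  have hℓ := natAbs_add_natAbs_le hδ x y
  calc |h x - h y| ≤ 32 * topGradConst * δ / r * (((y 0 - x 0).natAbs + (y 1 - x 1).natAbs : ℕ) : ℝ) := key
    _ = 32 * topGradConst / r * ((((y 0 - x 0).natAbs + (y 1 - x 1).natAbs : ℕ) : ℝ) * δ) := by ring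
    _ ≤ 32 * topGradConst / r * (2 * dist (meshPoint δ x) (meshPoint δ y)) := by gcongr
    _ = 64 * topGradConst / r * dist (meshPoint δ x) (meshPoint δ y) := by ring

/-- **Second-difference estimate, discretisation-free form** ([GP19], §4.1: the interior
gradient estimate applied to a discrete partial derivative, itself lattice harmonic and bounded
by `32 K δ / r` nearby). Let `0 < δ < r / 288` and `h : ℤ² → [0, 1]` be lattice harmonic on the
interior of every lattice box whose rescaled closed square lies in `B̄(z, r)`. Then
`|h(x + eₖ + eⱼ) - h(x + eₖ) - h(x + eⱼ) + h(x)| ≤ 4096 K² δ² / r²` at every lattice point `x` with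
mesh point in `B(z, r/16)`. [cite: GeorgakopoulosPanagiotis2019, §4.1] -/
theorem abs_second_diff_le_of_harmonicOnBoxes {z : ℂ} {r : ℝ} (hr : 0 < r) (hδ : 0 < δ)
    (hδr : δ < r / 288) {h : Site 2 → ℝ} (h01 : ∀ x, h x ∈ Icc (0 : ℝ) 1)
    (hharm : ∀ (a : Site 2) (N : ℕ),
      Complex.Rectangle (meshPoint δ a) (meshPoint δ (a + ![(N : ℤ), (N : ℤ)])) ⊆ closedBall z r →
        IsLatticeHarmonicOn h (boxInterior a N))
    (x : Site 2) (hx : meshPoint δ x ∈ ball z (r / 16)) (j k : Fin 4) :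
    |(h (x + cornerUnit k + cornerUnit j) - h (x + cornerUnit k)) - (h (x + cornerUnit j) - h x)| ≤
      4096 * topGradConst ^ 2 * δ ^ 2 / r ^ 2 := by
  have hδr' : δ < r / 72 := hδr.trans_le (by linarith)
  have hstep := abs_sub_le_of_harmonicOnBoxes hr hδ hδr' h01 hharm
  have hK := topGradConst_pos
  -- the box: side `2M`, `M = ⌊r / (32 δ)⌋ ≥ 8`, corner `a = x - (M, M)`
  set M : ℕ := ⌊r / (32 * δ)⌋₊ with hM
  have hMle : (M : ℝ) ≤ r / (32 * δ) := Nat.floor_le (by positivity)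
  have hMge : r / (32 * δ) - 1 ≤ M := (Nat.sub_one_lt_floor _).le
  have h9 : (9 : ℝ) ≤ r / (32 * δ) := by rw [le_div_iff₀ (by positivity)]; linarith
  have hM8 : 8 ≤ M := by
    have : (8 : ℝ) ≤ M := by linarith
    exact_mod_cast this
  set a : Site 2 := ![x 0 - M, x 1 - M] with ha
  have hxmid : x ∈ boxMiddle a (2 * M) := by
    refine ⟨?_, ?_, ?_, ?_⟩ <;> simp only [ha, Matrix.cons_val_zero, Matrix.cons_val_one] <;> push_cast <;> omega
  have h2M : 2 * δ * M ≤ r / 16 := by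
    have := mul_le_mul_of_nonneg_left hMle (by positivity : (0 : ℝ) ≤ 2 * δ)
    rwa [show 2 * δ * (r / (32 * δ)) = r / 16 by field_simp; ring] at this
  -- points of the closed square (and one step beyond) are within `r / 4` of `z`
  have hnear : ∀ y : Site 2, |((y 0 : ℝ)) - x 0| ≤ M + 1 → |((y 1 : ℝ)) - x 1| ≤ M + 1 →
      meshPoint δ y ∈ ball z (r / 4) := by
    intro y hy0 hy1
    rw [mem_ball]
    have hxz : dist (meshPoint δ x) z < r / 16 := mem_ball.1 hx
    have hyx : dist (meshPoint δ y) (meshPoint δ x) ≤ 2 * δ * (M + 1) := by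
      rw [Complex.dist_eq]
      refine (Complex.norm_le_abs_re_add_abs_im _).trans ?_
      simp only [Complex.sub_re, Complex.sub_im, meshPoint_re, meshPoint_im, ← mul_sub, abs_mul,
        abs_of_pos hδ]
      nlinarith
    calc dist (meshPoint δ y) z ≤ dist (meshPoint δ y) (meshPoint δ x) + dist (meshPoint δ x) z :=
          dist_triangle _ _ _
      _ < 2 * δ * (M + 1) + r / 16 := by linarith
      _ ≤ r / 4 := by nlinarith
  -- the bigger square (corner `a - (1,1)`, side `2M + 2`) lies in `B̄(z, r)`
  have hbig : Complex.Rectangle (meshPoint δ (a - ![1, 1]))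
      (meshPoint δ (a - ![1, 1] + ![((2 * M + 2 : ℕ) : ℤ), ((2 * M + 2 : ℕ) : ℤ)])) ⊆ closedBall z r := by
    intro pnt hp
    refine ball_subset_closedBall ((ball_subset_ball (by linarith : r / 4 ≤ r)) ?_)
    -- `pnt` is in the square of half-size `M + 1` about `x`
    have hp' : pnt ∈ Complex.Rectangle (meshPoint δ ![x 0 - ((M + 1 : ℕ) : ℤ), x 1 - ((M + 1 : ℕ) : ℤ)])
        (meshPoint δ (![x 0 - ((M + 1 : ℕ) : ℤ), x 1 - ((M + 1 : ℕ) : ℤ)] +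
          ![((2 * (M + 1) : ℕ) : ℤ), ((2 * (M + 1) : ℕ) : ℤ)])) := by
      convert hp using 3
      · ext i; fin_cases i <;> simp [ha] <;> ring
      · ext i; fin_cases i <;> simp [ha] <;> ring
    have hd := dist_le_of_mem_square hδ.le hp'
    rw [mem_ball]
    calc dist pnt z ≤ dist pnt (meshPoint δ x) + dist (meshPoint δ x) z := dist_triangle _ _ _
      _ < 2 * δ * ((M + 1 : ℕ) : ℝ) + r / 16 := by linarith [mem_ball.1 hx]
      _ ≤ r / 4 := by push_cast; nlinarith
  have hharm_big := hharm (a - ![1, 1]) (2 * M + 2) hbig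
  have hharmD := isLatticeHarmonicOn_diff (N := 2 * M) hharm_big j
  -- the discrete derivative is bounded by `32 K δ / r` on the sides of the box (indeed nearby)
  set Bd : ℝ := 32 * topGradConst * δ / r with hBd
  have hBd0 : 0 ≤ Bd := by positivity
  have hside : ∀ i : ℕ, 0 < i → i < 2 * M →
      |(fun y => h (y + cornerUnit j) - h y) ![a 0 + i, a 1 + (2 * M : ℕ)]| ≤ Bd ∧
      |(fun y => h (y + cornerUnit j) - h y) ![a 0 + i, a 1]| ≤ Bd ∧
      |(fun y => h (y + cornerUnit j) - h y) ![a 0, a 1 + i]| ≤ Bd ∧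
      |(fun y => h (y + cornerUnit j) - h y) ![a 0 + (2 * M : ℕ), a 1 + i]| ≤ Bd := by
    intro i hi hi'
    have hiM : (i : ℝ) < 2 * M := by exact_mod_cast hi'
    refine ⟨hstep _ (hnear _ ?_ ?_) j, hstep _ (hnear _ ?_ ?_) j,
      hstep _ (hnear _ ?_ ?_) j, hstep _ (hnear _ ?_ ?_) j⟩ <;>
      simp [ha] <;> rw [abs_le] <;> constructor <;> linarith
  have hgrad := harmonic_box_gradient_le a (2 * M) (by omega) hharmD hBd0 hside hxmid k
  -- rewrite and bound the constant
  have hN' : r / (32 * δ) ≤ ((2 * M : ℕ) : ℝ) := by push_cast; linarith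
  have hNpos : (0 : ℝ) < ((2 * M : ℕ) : ℝ) := by positivity
  have hfinal : 4 * topGradConst * Bd / ((2 * M : ℕ) : ℝ) ≤ 4096 * topGradConst ^ 2 * δ ^ 2 / r ^ 2 := by
    rw [div_le_div_iff₀ hNpos (by positivity), hBd]
    calc 4 * topGradConst * (32 * topGradConst * δ / r) * r ^ 2
        = 4096 * topGradConst ^ 2 * δ ^ 2 * (r / (32 * δ)) := by field_simp; ring
      _ ≤ 4096 * topGradConst ^ 2 * δ ^ 2 * ((2 * M : ℕ) : ℝ) := by gcongr
  calc |(h (x + cornerUnit k + cornerUnit j) - h (x + cornerUnit k)) - (h (x + cornerUnit j) - h x)|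
      = |(fun y => h (y + cornerUnit j) - h y) (x + cornerUnit k) - (fun y => h (y + cornerUnit j) - h y) x| := rfl
    _ ≤ 4 * topGradConst * Bd / ((2 * M : ℕ) : ℝ) := hgrad
    _ ≤ _ := hfinal

end KirchhoffSlope

end Summit.CriticalPhenomena.CardyFormulaZ2.Theorems
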